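import Summits.Ventures.CertifiedManyBodySolver.Downfold.EmeryShapeWindowClosure
import Summits.Ventures.CertifiedManyBodySolver.Downfold.EmeryFermiScalePointsBi2201M61VirtualCorners
import HarnessLib

/-!
# THE ONE-BAND FERMI-SURFACE SHAPE `t′/t` OF THE WHOLE TYPED 3BE BOX `emeryBoxBi2201M61MoreePPSrc (EmeryBoxesKSlicesN)` FROM TWO VIRTUAL CORNERS (two-ray rule + window closure, §B.86;
# router/EMERY-SHAPE-CORNERS.tsv)

Venture CertifiedManyBodySolver, cell `pub/hubbard-downfold` (stage S1; INFLATION-RULES-3to1-B §B.86 (i)), seat hubbard-downfold-mod-4 (technique B, g35); namespace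
`Summit.Ventures.CertifiedManyBodySolver.Downfold.Emery`. Everything PROVED (0 sorry). WHAT THIS IS NOT: a statement about Bi₂Sr₂CuO₆₊δ (M61; Morée PP source box) — the typed box is SCREENING-GRADE (its file's
grade line); `U = 0` one-body kinematics of the σ model (object E = the EXACT `t–t′` shape of the σ Fermi surface, `EmeryFermiSurfaceShape`); no interaction, no `t″`.

For EVERY one-body row `(Δ, t_pd, t_pp, t_pp′) ∈ [44/25, 59/25] × [5/4, 147/100] × [31/50, 37/50] × [7/50, 17/100]` eV and the fillings below, the one-band `t′/t` of the σ-model Fermi surface AT THAT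
ROW'S OWN FERMI ENERGY lies in the window of the table (device: `EmeryShapeTwoRayRule` + `EmeryShapeWindowClosure`, exactly as `EmeryBoxesLa214ShapeCorners`; virtual corners
`V_lo = (1.76, 1.25, 0.74, 0.2029)`, `V_hi = (2.36, 1.47, 0.62, 0.1173)`, t_pp′ outside the typed range by the factor b₂/b₁ = 1.194 — the explicit 3 → 1 inflation, zero iff the box is pure or of fixed
t_pp′/t_pp ratio; certificates `EmeryFermiScalePointsBi2201M61VirtualCorners`).

| filling | certified window for t′/t over the WHOLE box | V_lo ε_F bracket | V_hi ε_F bracket | lower closure | EMERY-FS-WINDOWS (g19 sub-box device) | object-E row of record [float] |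
|---|---|---|---|---|---|---|
| n_H = 1.144 (ν = 107/250) | **[-0.322, -0.2425]** | [1.6642, 1.6792] eV | [1.8991, 1.9091] eV | Lipschitz (dd ∈ [0.115, 0.224], M = 0.2244) | [-0.3162,-0.2456] (n_H band) | [-0.411,-0.310] |
| n_H = 1.176 (ν = 103/250) | **[-0.322, -0.2428]** | [1.6287, 1.6437] eV | [1.8696, 1.8796] eV | Lipschitz (dd ∈ [0.061, 0.169], M = 0.1689) | [-0.3162,-0.2456] (n_H band) | [-0.411,-0.310] |

Sources: three-band model [HybertsenSchluterChristensen1989, Eq. (1)]; [AndersenEtAl1995, §6]; box rows as cited in the typed object's file.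
-/

noncomputable section

namespace Summit.Ventures.CertifiedManyBodySolver.Downfold.Emery

open Real Set

/-- **n_H = 1.144 (ν = 107/250): for every row of the box the one-band Fermi-surface `t′/t` (object E, at the row's own Fermi energy) lies in `[-0.322, -0.2425]`.** Lower closure: lipschitz; upper: monotone. [folklore] -/
theorem bi2201M61Box_fsRatio_nH1144 {Δ a b c : ℝ} (hΔ : Δ ∈ Icc ((44 : ℝ) / 25) ((59 : ℝ) / 25)) (ha : a ∈ Icc ((5 : ℝ) / 4) ((147 : ℝ) / 100)) (hb : b ∈ Icc ((31 : ℝ) / 50) ((37 : ℝ) / 50)) (hc : c ∈ Icc ((7 : ℝ) / 50) ((17 : ℝ) / 100)) :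
    fsRatio Δ a b c (fermiEnergyOf Δ a b c ((107 : ℝ) / 250)) ∈ Icc ((-161 : ℝ) / 500) ((-97 : ℝ) / 400) := by
  have hV : ((17 : ℝ) / 100) * ((37 : ℝ) / 50) / ((31 : ℝ) / 50) = ((629 : ℝ) / 3100) := by norm_num
  have hW : ((7 : ℝ) / 50) * ((31 : ℝ) / 50) / ((37 : ℝ) / 50) = ((217 : ℝ) / 1850) := by norm_num
  have hVlo := (fermiEnergyOf_of_pointBracketCheck virtPt_Bi2201M61Vlo_nH1144_br (by norm_num) (by norm_num) (by norm_num) (ν := (107/250 : ℝ)) (by push_cast; exact ⟨le_rfl, le_rfl⟩)).2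
  have hVhi := (fermiEnergyOf_of_pointBracketCheck virtPt_Bi2201M61Vhi_nH1144_br (by norm_num) (by norm_num) (by norm_num) (ν := (107/250 : ℝ)) (by push_cast; exact ⟨le_rfl, le_rfl⟩)).2
  have hAlo := (fermiEnergyOf_of_pointBracketCheck virtPt_Bi2201M61Alo_nH1144_br (by norm_num) (by norm_num) (by norm_num) (ν := (107/250 : ℝ)) (by push_cast; exact ⟨le_rfl, le_rfl⟩)).2
  have hTop := (fermiEnergyOf_of_pointBracketCheck virtPt_Bi2201M61H_nH1144_br (by norm_num) (by norm_num) (by norm_num) (ν := (107/250 : ℝ)) (by push_cast; exact ⟨le_rfl, le_rfl⟩)).2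
  push_cast at hVlo hVhi hAlo hTop
  norm_num at hVlo hVhi hAlo hTop
  refine fsRatio_fermiEnergyOf_mem_Icc_windowClosure (Δ₁ := ((44 : ℝ) / 25)) (Δ₂ := ((59 : ℝ) / 25)) (a₁ := ((5 : ℝ) / 4)) (a₂ := ((147 : ℝ) / 100)) (b₁ := ((31 : ℝ) / 50))
    (b₂ := ((37 : ℝ) / 50)) (c₁ := ((7 : ℝ) / 50)) (c₂ := ((17 : ℝ) / 100)) (e₁ := ((8321 : ℝ) / 5000)) (e₂ := ((8673 : ℝ) / 5000)) (e₃ := 0) (e₄ := ((19091 : ℝ) / 10000)) (by norm_num) (by norm_num) (by norm_num) (by norm_num)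
    (by norm_num) hΔ ha hb hc (by norm_num) (by norm_num) ?_ ?_ ?_ (by norm_num) ?_ ?_ ?_ (by norm_num) ?_
  · -- regime at the box's Fermi-energy high corner: c₂ b₂ ε_F(Δ₁, a₂, b₂, c₁) ≤ a₁² b₁
    nlinarith [hTop.2]
  · rw [hV]; exact hVlo.1
  · exact hAlo.2
  · intro ε hε
    rw [hV]
    have hlip := fsRatio_ge_on_window (Δ := ((44 : ℝ) / 25)) (a := ((5 : ℝ) / 4)) (b := ((37 : ℝ) / 50)) (c := ((629 : ℝ) / 3100)) (p := ((8321 : ℝ) / 5000)) (q := ((8673 : ℝ) / 5000))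
      (M := ((561 : ℝ) / 2500)) (by norm_num) (by norm_num) (by norm_num) (by norm_num) (by norm_num [fsD, fsN]) (by norm_num [dopingDisc]) (by norm_num [dopingDisc]) hε
    refine le_trans ?_ hlip
    norm_num [fsRatio, fsD, fsN]
  · exact (fermiEnergyOf_pos (by norm_num) (by norm_num) (by norm_num) (by norm_num) (by norm_num) (by norm_num)).le
  · rw [hW]; exact hVhi.2
  · intro ε hε
    rw [hW]
    have hmono := (fsRatio_mem_Icc_on_window_of_dopingDisc_nonpos (Δ := ((59 : ℝ) / 25)) (a := ((147 : ℝ) / 100)) (b := ((31 : ℝ) / 50)) (c := ((217 : ℝ) / 1850))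
      (p := 0) (q := ((19091 : ℝ) / 10000)) (by norm_num) (by norm_num) (by norm_num) (by norm_num) (by norm_num) (by norm_num) (by norm_num)
      (by norm_num [dopingDisc]) hε).2
    refine le_trans hmono ?_
    norm_num [fsRatio, fsD, fsN]

/-- **n_H = 1.176 (ν = 103/250): for every row of the box the one-band Fermi-surface `t′/t` (object E, at the row's own Fermi energy) lies in `[-0.322, -0.2428]`.** Lower closure: lipschitz; upper: monotone. [folklore] -/
theorem bi2201M61Box_fsRatio_nH1176 {Δ a b c : ℝ} (hΔ : Δ ∈ Icc ((44 : ℝ) / 25) ((59 : ℝ) / 25)) (ha : a ∈ Icc ((5 : ℝ) / 4) ((147 : ℝ) / 100)) (hb : b ∈ Icc ((31 : ℝ) / 50) ((37 : ℝ) / 50)) (hc : c ∈ Icc ((7 : ℝ) / 50) ((17 : ℝ) / 100)) :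
    fsRatio Δ a b c (fermiEnergyOf Δ a b c ((103 : ℝ) / 250)) ∈ Icc ((-161 : ℝ) / 500) ((-607 : ℝ) / 2500) := by
  have hV : ((17 : ℝ) / 100) * ((37 : ℝ) / 50) / ((31 : ℝ) / 50) = ((629 : ℝ) / 3100) := by norm_num
  have hW : ((7 : ℝ) / 50) * ((31 : ℝ) / 50) / ((37 : ℝ) / 50) = ((217 : ℝ) / 1850) := by norm_num
  have hVlo := (fermiEnergyOf_of_pointBracketCheck virtPt_Bi2201M61Vlo_nH1176_br (by norm_num) (by norm_num) (by norm_num) (ν := (103/250 : ℝ)) (by push_cast; exact ⟨le_rfl, le_rfl⟩)).2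
  have hVhi := (fermiEnergyOf_of_pointBracketCheck virtPt_Bi2201M61Vhi_nH1176_br (by norm_num) (by norm_num) (by norm_num) (ν := (103/250 : ℝ)) (by push_cast; exact ⟨le_rfl, le_rfl⟩)).2
  have hAlo := (fermiEnergyOf_of_pointBracketCheck virtPt_Bi2201M61Alo_nH1176_br (by norm_num) (by norm_num) (by norm_num) (ν := (103/250 : ℝ)) (by push_cast; exact ⟨le_rfl, le_rfl⟩)).2
  have hTop := (fermiEnergyOf_of_pointBracketCheck virtPt_Bi2201M61H_nH1176_br (by norm_num) (by norm_num) (by norm_num) (ν := (103/250 : ℝ)) (by push_cast; exact ⟨le_rfl, le_rfl⟩)).2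
  push_cast at hVlo hVhi hAlo hTop
  norm_num at hVlo hVhi hAlo hTop
  refine fsRatio_fermiEnergyOf_mem_Icc_windowClosure (Δ₁ := ((44 : ℝ) / 25)) (Δ₂ := ((59 : ℝ) / 25)) (a₁ := ((5 : ℝ) / 4)) (a₂ := ((147 : ℝ) / 100)) (b₁ := ((31 : ℝ) / 50))
    (b₂ := ((37 : ℝ) / 50)) (c₁ := ((7 : ℝ) / 50)) (c₂ := ((17 : ℝ) / 100)) (e₁ := ((16287 : ℝ) / 10000)) (e₂ := ((4247 : ℝ) / 2500)) (e₃ := 0) (e₄ := ((4699 : ℝ) / 2500)) (by norm_num) (by norm_num) (by norm_num) (by norm_num)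
    (by norm_num) hΔ ha hb hc (by norm_num) (by norm_num) ?_ ?_ ?_ (by norm_num) ?_ ?_ ?_ (by norm_num) ?_
  · -- regime at the box's Fermi-energy high corner: c₂ b₂ ε_F(Δ₁, a₂, b₂, c₁) ≤ a₁² b₁
    nlinarith [hTop.2]
  · rw [hV]; exact hVlo.1
  · exact hAlo.2
  · intro ε hε
    rw [hV]
    have hlip := fsRatio_ge_on_window (Δ := ((44 : ℝ) / 25)) (a := ((5 : ℝ) / 4)) (b := ((37 : ℝ) / 50)) (c := ((629 : ℝ) / 3100)) (p := ((16287 : ℝ) / 10000)) (q := ((4247 : ℝ) / 2500))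
      (M := ((1689 : ℝ) / 10000)) (by norm_num) (by norm_num) (by norm_num) (by norm_num) (by norm_num [fsD, fsN]) (by norm_num [dopingDisc]) (by norm_num [dopingDisc]) hε
    refine le_trans ?_ hlip
    norm_num [fsRatio, fsD, fsN]
  · exact (fermiEnergyOf_pos (by norm_num) (by norm_num) (by norm_num) (by norm_num) (by norm_num) (by norm_num)).le
  · rw [hW]; exact hVhi.2
  · intro ε hε
    rw [hW]
    have hmono := (fsRatio_mem_Icc_on_window_of_dopingDisc_nonpos (Δ := ((59 : ℝ) / 25)) (a := ((147 : ℝ) / 100)) (b := ((31 : ℝ) / 50)) (c := ((217 : ℝ) / 1850))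
      (p := 0) (q := ((4699 : ℝ) / 2500)) (by norm_num) (by norm_num) (by norm_num) (by norm_num) (by norm_num) (by norm_num) (by norm_num)
      (by norm_num [dopingDisc]) hε).2
    refine le_trans hmono ?_
    norm_num [fsRatio, fsD, fsN]

end Summit.Ventures.CertifiedManyBodySolver.Downfold.Emery
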